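import Literature.NumberTheory.Sieve.GallagherPrimesInShortIntervals
import Literature.NumberTheory.Sieve.PrimeGapLimitPoints
import HarnessLib

/-!
# From the Poisson law for prime-free windows to limit points of normalized prime gaps:
# `P₀(h, N) ∼ e^{−λ} N` for all `λ > 0` ⇒ every `t ≥ 0` is a limit point of `(p_{n+1} − p_n)/log p_n`

This is the last step of the classical deduction "uniform Hardy–Littlewood prime `k`-tuple conjecture
⇒ the set `𝓛` of limit points of normalized prime gaps is all of `[0, ∞]`" via Gallagher's theorem
(P. X. Gallagher, Mathematika 23 (1976) 4–9, Theorem 1, case `k = 0`: "the number `P₀(h, N)` of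
`n ≤ N` for which `(n, n+h]` contains no prime is `∼ N e^{−λ}`, `h ∼ λ log N`"), as recorded in
J. Merikoski, *Limit points of normalized prime gaps* (arXiv:1811.03008, §1: "assuming a uniform version
of the Hardy–Littlewood prime `k`-tuples conjecture, Gallagher's theorem implies `𝓛 = [0, ∞]`").
Tree vocabulary: `Literature.NumberTheory.Sieve.primeGapLimitSet` (`PrimeGapLimitPoints.lean`),
`Gallagher.exactCount 0 h N = P₀(h, N)` (`GallagherPrimesInShortIntervals.lean`).

Everything here is PROVED; the Poisson law enters as an explicit hypothesis (it is the conclusion of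
`Gallagher.Gallagher1976_theorem1`).  The deduction is elementary but not Gallagher's (he stops at the
distribution of `π(n+h) − π(n)`); we record it as the folklore step it is, with a pointwise
second-difference count that avoids indexing the gaps:

* §1 `nextPrime m` (least prime `> m`), `exactCount_zero_eq` (`P₀(H, N) = #{m ≤ N : m + H < nextPrime m}`),
  `nextPrime_nth_prime` (`nextPrime p_j = p_{j+1}`);
* §2 `secondDiff_exactCount_le` — for `D ≤ H`:
  `P₀(H−D, N) − 2 P₀(H, N) + P₀(H+D, N) ≤ D · #{p ≤ N prime : H − D < p⁺ − p < H + D} + D`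
  (`p⁺ = nextPrime p`), by pairing `m ↦ m − D` when `(m − D, m]` is prime-free and `m ↦` (largest
  prime `≤ m`) otherwise;
* §3 `Ici_subset_primeGapLimitSet_of_poisson` — if `P₀(g(N), N)/N → e^{−s}` whenever
  `g(N)/log N → s > 0`, then `Set.Ici 0 ⊆ primeGapLimitSet`: the second difference at
  `H = ⌊t log N⌋`, `D = ⌊δ log N⌋` is `∼ e^{−t}(e^{δ} + e^{−δ} − 2) N > 0`, forcing `≫ N / log N`
  primes `p ≤ N` with `p⁺ − p ∈ ((t−δ) log N, (t+δ) log N)`, hence one with `p > N / log² N`;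
  `0 ∈ 𝓛` then follows because `𝓛` is closed (`isClosed_primeGapLimitSet`).
-/

noncomputable section

open Filter Finset Real
open scoped Topology

namespace Literature.NumberTheory.Sieve.Gallagher

/-! ### §1 The next prime and prime-free windows -/

/-- The least prime `> m`. [folklore] -/
def nextPrime (m : ℕ) : ℕ := Nat.find (Nat.exists_infinite_primes (m + 1))

/-- Defining property of `nextPrime`. [folklore] -/
private theorem nextPrime_spec (m : ℕ) : m + 1 ≤ nextPrime m ∧ (nextPrime m).Prime :=
  Nat.find_spec (Nat.exists_infinite_primes (m + 1))

/-- `m < nextPrime m`. [folklore] -/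
private theorem lt_nextPrime (m : ℕ) : m < nextPrime m := (nextPrime_spec m).1

/-- `nextPrime m` is prime. [folklore] -/
private theorem nextPrime_prime (m : ℕ) : (nextPrime m).Prime := (nextPrime_spec m).2

/-- Minimality of `nextPrime`. [folklore] -/
private theorem nextPrime_le {m q : ℕ} (hq : q.Prime) (hmq : m < q) : nextPrime m ≤ q :=
  Nat.find_min' _ ⟨hmq, hq⟩

/-- If `(a, b]` contains no prime then `a` and `b` have the same next prime. [folklore] -/
private theorem nextPrime_eq_of_noPrime {a b : ℕ} (hab : a ≤ b)
    (h : ∀ q, q.Prime → a < q → b < q) : nextPrime a = nextPrime b := by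
  refine le_antisymm (nextPrime_le (nextPrime_prime b) (lt_of_le_of_lt hab (lt_nextPrime b))) ?_
  exact nextPrime_le (nextPrime_prime a) (h _ (nextPrime_prime a) (lt_nextPrime a))

/-- `(m, m + H]` is prime-free iff `m + H < nextPrime m`. [folklore] -/
private theorem windowCount_eq_zero_iff (m H : ℕ) : windowCount m H = 0 ↔ m + H < nextPrime m := by
  unfold windowCount
  rw [card_eq_zero, filter_eq_empty_iff]
  constructor
  · intro h
    by_contra hle
    push Not at hle
    exact h (x := nextPrime m) (by simp [mem_Ioc, lt_nextPrime m, hle]) (nextPrime_prime m)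
  · intro h q hq hqp
    rw [mem_Ioc] at hq
    exact absurd (nextPrime_le hqp hq.1) (by omega)

/-- `P₀(H, N) = #{1 ≤ m ≤ N : m + H < nextPrime m}`. [folklore] -/
private theorem exactCount_zero_eq (H N : ℕ) :
    exactCount 0 H N = #((Icc 1 N).filter fun m => m + H < nextPrime m) := by
  unfold exactCount
  congr 1
  ext m
  simp only [mem_filter, windowCount_eq_zero_iff]

/-- The next prime after the `j`-th prime is the `(j+1)`-st prime. [folklore] -/
private theorem nextPrime_nth_prime (j : ℕ) :
    nextPrime (Nat.nth Nat.Prime j) = Nat.nth Nat.Prime (j + 1) := by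
  have hinf := Nat.infinite_setOf_prime
  refine le_antisymm ?_ ?_
  · exact nextPrime_le (Nat.nth_mem_of_infinite hinf (j + 1))
      ((Nat.nth_strictMono hinf) (Nat.lt_succ_self j))
  · by_contra hlt
    push Not at hlt
    have h1 := Nat.le_nth_of_lt_nth_succ hlt (nextPrime_prime _)
    exact absurd h1 (not_le.2 (lt_nextPrime _))

/-! ### §2 The second-difference inequality -/

/-- **Second-difference count.**  For `D ≤ H` and any `N`,
`P₀(H−D, N) − 2 P₀(H, N) + P₀(H+D, N) ≤ D · #{1 ≤ p ≤ N prime : H − D < p⁺ − p < H + D} + D`,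
where `p⁺ = nextPrime p`.  Proof: with `r(m) = nextPrime m − m`, the left side is `#A − #B`,
`A = {m ≤ N : H − D < r(m) ≤ H}`, `B = {m ≤ N : H < r(m) ≤ H + D}`; an `m ∈ A` with `m > D` and
`(m−D, m]` prime-free maps injectively to `m − D ∈ B`; an `m ∈ A` with a prime in `(m−D, m]` maps to
the largest prime `p ≤ m`, which then has `p⁺ − p = r(m) + (m − p) ∈ (H−D, H+D)`, each `p` receiving at
most `D` such `m`; and at most `D` values `m ≤ D` remain.  (Our elementary route from Gallagher's
`P₀(h, N)` to individual gaps; the source states the gap-distribution consequence (1.1) of Gallagher's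
theorem without this bookkeeping.) [cite: Merikoski2020GapLimitPoints, Section 1 eq. (1.1)] -/
theorem secondDiff_exactCount_le {H D : ℕ} (hDH : D ≤ H) (N : ℕ) :
    (exactCount 0 (H - D) N : ℤ) - 2 * exactCount 0 H N + exactCount 0 (H + D) N ≤
      D * #((Icc 1 N).filter fun p => p.Prime ∧ H - D < nextPrime p - p ∧ nextPrime p - p < H + D)
        + D := by
  classical
  set S := Icc 1 N with hS
  set A := S.filter fun m => m + (H - D) < nextPrime m ∧ ¬ m + H < nextPrime m with hA
  set B := S.filter fun m => m + H < nextPrime m ∧ ¬ m + (H + D) < nextPrime m with hB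
  set P := S.filter fun p => p.Prime ∧ H - D < nextPrime p - p ∧ nextPrime p - p < H + D with hP
  -- the three window counts split along `A` and `B`
  have hW1 : exactCount 0 (H - D) N = exactCount 0 H N + #A := by
    rw [exactCount_zero_eq, exactCount_zero_eq, hA, ← card_union_of_disjoint]
    · congr 1
      ext m
      simp only [mem_filter, mem_union]
      constructor
      · intro ⟨hm, h⟩
        by_cases h' : m + H < nextPrime m
        · exact Or.inl ⟨hm, h'⟩
        · exact Or.inr ⟨hm, h, h'⟩
      · rintro (⟨hm, h⟩ | ⟨hm, h, -⟩)
        · exact ⟨hm, by omega⟩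
        · exact ⟨hm, h⟩
    · rw [disjoint_filter]
      intro m _ h1 h2
      exact h2.2 h1
  have hW2 : exactCount 0 H N = exactCount 0 (H + D) N + #B := by
    rw [exactCount_zero_eq, exactCount_zero_eq, hB, ← card_union_of_disjoint]
    · congr 1
      ext m
      simp only [mem_filter, mem_union]
      constructor
      · intro ⟨hm, h⟩
        by_cases h' : m + (H + D) < nextPrime m
        · exact Or.inl ⟨hm, h'⟩
        · exact Or.inr ⟨hm, h, h'⟩
      · rintro (⟨hm, h⟩ | ⟨hm, h, -⟩)
        · exact ⟨hm, by omega⟩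
        · exact ⟨hm, h⟩
    · rw [disjoint_filter]
      intro m _ h1 h2
      exact h2.2 h1
  -- it remains to bound `#A ≤ #B + D #P + D`
  suffices hAB : #A ≤ #B + D * #P + D by
    rw [hW1, hW2]; push_cast; linarith [(by exact_mod_cast hAB : (#A : ℤ) ≤ #B + D * #P + D)]
  -- split `A`
  set A₁ := A.filter fun m => m ≤ D with hA₁
  set A₂ := A.filter fun m => D < m ∧ m < nextPrime (m - D) with hA₂
  set A₃ := A.filter fun m => D < m ∧ nextPrime (m - D) ≤ m with hA₃
  have hsplit : A ⊆ A₁ ∪ (A₂ ∪ A₃) := by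
    intro m hm
    simp only [hA₁, hA₂, hA₃, mem_union, mem_filter]
    by_cases h1 : m ≤ D
    · exact Or.inl ⟨hm, h1⟩
    · by_cases h2 : m < nextPrime (m - D)
      · exact Or.inr (Or.inl ⟨hm, by omega, h2⟩)
      · exact Or.inr (Or.inr ⟨hm, by omega, by omega⟩)
  have hcard : #A ≤ #A₁ + (#A₂ + #A₃) :=
    (card_le_card hsplit).trans ((card_union_le _ _).trans (by gcongr; exact card_union_le _ _))
  -- `#A₁ ≤ D`
  have h1 : #A₁ ≤ D := by
    calc #A₁ ≤ #(Icc 1 D) := card_le_card fun m hm => by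
            simp only [hA₁, hA, hS, mem_filter, mem_Icc] at hm ⊢
            exact ⟨hm.1.1.1, hm.2⟩
      _ = D := by simp
  -- `#A₂ ≤ #B` via `m ↦ m − D`
  have h2 : #A₂ ≤ #B := by
    refine card_le_card_of_injOn (fun m => m - D) (fun m hm => ?_) (fun a ha b hb hab => ?_)
    · simp only [hA₂, hA, hS, mem_coe, mem_filter, mem_Icc] at hm
      obtain ⟨⟨⟨hm1, hmN⟩, hlo, hhi⟩, hDm, hfree⟩ := hm
      -- no prime in `(m − D, m]`, so the next primes agree
      have heq : nextPrime (m - D) = nextPrime m := by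
        refine nextPrime_eq_of_noPrime (Nat.sub_le m D) fun q hq hq1 => ?_
        by_contra hqm
        push Not at hqm
        exact absurd (nextPrime_le hq hq1) (not_le.2 (lt_of_le_of_lt hqm hfree))
      simp only [hB, hS, mem_coe, mem_filter, mem_Icc]
      refine ⟨⟨by omega, by omega⟩, ?_, ?_⟩
      · rw [heq]; omega
      · rw [heq]; omega
    · simp only [hA₂, mem_coe, mem_filter] at ha hb
      have hab' : a - D = b - D := hab
      have := ha.2.1; have := hb.2.1
      omega
  -- `#A₃ ≤ D * #P` via `m ↦` largest prime `≤ m`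
  have h3 : #A₃ ≤ D * #P := by
    set g : ℕ → ℕ := fun m => Nat.findGreatest Nat.Prime m with hg
    -- properties of `g m` for `m ∈ A₃`
    have hprops : ∀ m ∈ A₃, (g m).Prime ∧ m - D < g m ∧ g m ≤ m ∧ nextPrime (g m) = nextPrime m := by
      intro m hm
      simp only [hA₃, hA, hS, mem_filter, mem_Icc] at hm
      obtain ⟨⟨⟨hm1, hmN⟩, hlo, hhi⟩, hDm, hle⟩ := hm
      have hq := nextPrime_prime (m - D)
      have hq1 := lt_nextPrime (m - D)
      have hgp : (g m).Prime := Nat.findGreatest_spec hle hq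
      have hqg : nextPrime (m - D) ≤ g m := Nat.le_findGreatest hle hq
      have hgm : g m ≤ m := Nat.findGreatest_le m
      refine ⟨hgp, lt_of_lt_of_le hq1 hqg, hgm, ?_⟩
      refine nextPrime_eq_of_noPrime hgm fun q hq' hgq => ?_
      by_contra hqm
      push Not at hqm
      exact Nat.findGreatest_is_greatest hgq hqm hq'
    have himg : A₃.image g ⊆ P := by
      intro p hp
      rw [mem_image] at hp
      obtain ⟨m, hm, rfl⟩ := hp
      obtain ⟨hgp, hlo', hgm, heq⟩ := hprops m hm
      simp only [hA₃, hA, hS, mem_filter, mem_Icc] at hm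
      obtain ⟨⟨⟨hm1, hmN⟩, hlo, hhi⟩, hDm, hle⟩ := hm
      simp only [hP, hS, mem_filter, mem_Icc]
      have := lt_nextPrime m
      refine ⟨⟨hgp.one_lt.le, hgm.trans hmN⟩, hgp, ?_, ?_⟩
      · rw [heq]; omega
      · rw [heq]; omega
    have hfib : ∀ p ∈ A₃.image g, #(A₃.filter fun m => g m = p) ≤ D := by
      intro p hp
      calc #(A₃.filter fun m => g m = p) ≤ #(Ico p (p + D)) := card_le_card fun m hm => by
              rw [mem_filter] at hm
              obtain ⟨hm, rfl⟩ := hm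
              obtain ⟨-, hlo', hgm, -⟩ := hprops m hm
              rw [mem_Ico]; omega
        _ = D := by simp
    calc #A₃ ≤ D * #(A₃.image g) := card_le_mul_card_image A₃ D hfib
      _ ≤ D * #P := Nat.mul_le_mul_left D (card_le_card himg)
  omega

/-! ### §3 Limit points of normalized prime gaps -/

/-- `log N → ∞` along the naturals. [folklore] -/
private theorem tendsto_log_natCast_atTop : Tendsto (fun N : ℕ => Real.log N) atTop atTop :=
  Real.tendsto_log_atTop.comp tendsto_natCast_atTop_atTop

/-- `⌊c log N⌋ / log N → c` for `c ≥ 0`. [folklore] -/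
private theorem tendsto_floor_mul_log_div {c : ℝ} (hc : 0 ≤ c) :
    Tendsto (fun N : ℕ => (⌊c * Real.log N⌋₊ : ℝ) / Real.log N) atTop (𝓝 c) := by
  have hlog := tendsto_log_natCast_atTop
  have hinv : Tendsto (fun N : ℕ => (Real.log N)⁻¹) atTop (𝓝 0) := hlog.inv_tendsto_atTop
  have hlow : Tendsto (fun N : ℕ => c - (Real.log N)⁻¹) atTop (𝓝 c) := by
    simpa using tendsto_const_nhds.sub hinv
  refine tendsto_of_tendsto_of_tendsto_of_le_of_le' hlow tendsto_const_nhds ?_ ?_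
  · filter_upwards [eventually_ge_atTop 2] with N hN
    have hL : 0 < Real.log N := Real.log_pos (by exact_mod_cast hN)
    rw [le_div_iff₀ hL, sub_mul, inv_mul_cancel₀ hL.ne']
    have := Nat.lt_floor_add_one (c * Real.log N)
    linarith
  · filter_upwards [eventually_ge_atTop 2] with N hN
    have hL : 0 < Real.log N := Real.log_pos (by exact_mod_cast hN)
    rw [div_le_iff₀ hL]
    exact Nat.floor_le (mul_nonneg hc hL.le)

/-- Strict convexity of `e^{−x}` at the three points `t − δ, t, t + δ`. [folklore] -/
private theorem exp_secondDiff_pos (t : ℝ) {δ : ℝ} (hδ : δ ≠ 0) :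
    0 < Real.exp (-(t - δ)) - 2 * Real.exp (-t) + Real.exp (-(t + δ)) := by
  have h1 : Real.exp (-(t - δ)) = Real.exp (-t) * Real.exp δ := by
    rw [← Real.exp_add]; ring_nf
  have h2 : Real.exp (-(t + δ)) = Real.exp (-t) * Real.exp (-δ) := by
    rw [← Real.exp_add]; ring_nf
  rw [h1, h2]
  have hδ1 := Real.add_one_lt_exp hδ
  have hδ2 := Real.add_one_lt_exp (neg_ne_zero.2 hδ)
  have ht : 0 < Real.exp (-t) := Real.exp_pos _
  nlinarith

/-- `(log N)^n ≤ c N` eventually along the naturals, for any `c > 0`. [folklore] -/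
private theorem eventually_pow_log_le (n : ℕ) {c : ℝ} (hc : 0 < c) :
    ∀ᶠ N : ℕ in atTop, Real.log N ^ n ≤ c * N := by
  have h := ((Real.isLittleO_pow_log_id_atTop (n := n)).comp_tendsto
    tendsto_natCast_atTop_atTop).def hc
  simp only [Function.comp_def, id_eq, Real.norm_eq_abs, Nat.abs_cast] at h
  filter_upwards [h] with N hN
  rwa [abs_of_nonneg (pow_nonneg (Real.log_natCast_nonneg N) n)] at hN

/-- `log (log N) ≤ c log N` eventually, for any `c > 0`. [folklore] -/
private theorem eventually_loglog_le {c : ℝ} (hc : 0 < c) :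
    ∀ᶠ N : ℕ in atTop, Real.log (Real.log N) ≤ c * Real.log N := by
  have h := (Real.isLittleO_log_id_atTop.comp_tendsto tendsto_log_natCast_atTop).def hc
  simp only [Function.comp_def, id_eq, Real.norm_eq_abs] at h
  filter_upwards [h, tendsto_log_natCast_atTop.eventually (eventually_ge_atTop 1)] with N hN hN1
  rwa [abs_of_nonneg (Real.log_nonneg hN1), abs_of_nonneg (zero_le_one.trans hN1)] at hN

/-- Real arithmetic, step 1: `κN/2 < T ≤ D(P+1)`, `0 < D ≤ δL` give `κN/(2δL) − 1 ≤ P`. [folklore] -/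
private theorem card_lower_aux {κ δ L N D P T : ℝ} (hδ : 0 < δ) (hL : 0 < L) (hP : 0 ≤ P)
    (hT : κ / 2 * N < T) (hTle : T ≤ D * (P + 1)) (hDle : D ≤ δ * L) :
    κ * N / (2 * (δ * L)) - 1 ≤ P := by
  have hδL : 0 < δ * L := mul_pos hδ hL
  have h2 : κ / 2 * N < δ * L * (P + 1) := by
    have hP0 : (0 : ℝ) ≤ P + 1 := by linarith
    nlinarith
  rw [sub_le_iff_le_add, div_le_iff₀ (by positivity)]
  nlinarith

/-- Real arithmetic, step 2: `1/L ≤ κ/(4δ)` and `8δ/κ ≤ N/L` give `N/L² + 1 ≤ κN/(2δL) − 1`.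
[folklore] -/
private theorem key_aux {κ δ L N : ℝ} (hκ : 0 < κ) (hδ : 0 < δ) (hL : 0 < L) (hN : 0 ≤ N)
    (h3 : 4 * δ / κ ≤ L) (h4 : L ≤ κ / (8 * δ) * N) :
    N / L ^ 2 + 1 ≤ κ * N / (2 * (δ * L)) - 1 := by
  have hNL : 0 ≤ N / L := by positivity
  have h3' : 1 / L ≤ κ / (4 * δ) := by
    have := (div_le_iff₀ hκ).1 h3
    rw [div_le_div_iff₀ hL (by positivity)]
    linarith
  have h4' : 8 * δ / κ ≤ N / L := by
    have := mul_le_mul_of_nonneg_left h4 (by positivity : (0 : ℝ) ≤ 8 * δ)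
    rw [show 8 * δ * (κ / (8 * δ) * N) = κ * N by field_simp] at this
    rw [div_le_div_iff₀ hκ hL]
    linarith
  have e : N / L ^ 2 = (N / L) * (1 / L) := by field_simp
  have e' : κ * N / (2 * (δ * L)) = (N / L) * (κ / (2 * δ)) := by field_simp
  rw [e, e']
  have h5 : N / L * (1 / L) ≤ N / L * (κ / (4 * δ)) := mul_le_mul_of_nonneg_left h3' hNL
  have h8 : (2 : ℝ) ≤ N / L * (κ / (4 * δ)) := by
    have := mul_le_mul_of_nonneg_right h4' (by positivity : (0 : ℝ) ≤ κ / (4 * δ))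
    rwa [show 8 * δ / κ * (κ / (4 * δ)) = (2 : ℝ) by field_simp; ring] at this
  have e'' : N / L * (κ / (2 * δ)) = 2 * (N / L * (κ / (4 * δ))) := by field_simp; ring
  rw [e'']
  linarith

/-- Real arithmetic, step 3 (upper bound for the normalized gap). [folklore] -/
private theorem upper_aux {t δ L lgL lp g : ℝ} (ht : 0 < t) (hδ : 0 < δ) (hg : 0 ≤ g)
    (hgL : g < (t + δ) * L) (hL' : 0 < L - 2 * lgL) (hlp : L - 2 * lgL < lp)
    (h6 : lgL ≤ δ / (2 * (t + 2 * δ)) * L) : g / lp < t + 2 * δ := by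
  have h1 : g / lp ≤ g / (L - 2 * lgL) := div_le_div_of_nonneg_left hg hL' hlp.le
  have h2 : g / (L - 2 * lgL) < (t + δ) * L / (L - 2 * lgL) := div_lt_div_of_pos_right hgL hL'
  have h3 : (t + δ) * L / (L - 2 * lgL) ≤ t + 2 * δ := by
    rw [div_le_iff₀ hL']
    have htd : 0 < t + 2 * δ := by linarith
    have : 2 * (t + 2 * δ) * lgL ≤ δ * L := by
      have := mul_le_mul_of_nonneg_left h6 (by positivity : (0 : ℝ) ≤ 2 * (t + 2 * δ))
      rwa [show 2 * (t + 2 * δ) * (δ / (2 * (t + 2 * δ)) * L) = δ * L by field_simp] at this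
    nlinarith
  linarith

/-- Real arithmetic, step 4 (lower bound for the normalized gap). [folklore] -/
private theorem lower_aux {t δ L lp g : ℝ} (hδ : 0 < δ) (hL : 0 < L) (hg : 0 ≤ g)
    (hgL : (t - δ) * L - 1 < g) (hlp : 0 < lp) (hlpL : lp ≤ L) (h7 : 1 / δ ≤ L) :
    t - 2 * δ < g / lp := by
  have h1 : g / L ≤ g / lp := div_le_div_of_nonneg_left hg hlp hlpL
  have h2 : ((t - δ) * L - 1) / L < g / L := div_lt_div_of_pos_right hgL hL
  have h3 : t - 2 * δ ≤ ((t - δ) * L - 1) / L := by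
    rw [le_div_iff₀ hL]
    rw [div_le_iff₀ hδ] at h7
    nlinarith
  linarith

/-- Pigeonhole: a set of naturals `≥ 1` with more than `M` elements has an element `> M`. [folklore] -/
private theorem exists_gt_of_card_gt {P : Finset ℕ} {M : ℕ} (h1 : ∀ p ∈ P, 1 ≤ p) (hM : M < #P) :
    ∃ p ∈ P, M < p := by
  by_contra hcon
  push Not at hcon
  have hsub : P ⊆ Icc 1 M := fun p hp => mem_Icc.2 ⟨h1 p hp, hcon p hp⟩
  have := card_le_card hsub
  rw [Nat.card_Icc, Nat.add_sub_cancel] at this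
  omega

set_option maxHeartbeats 400000 in
-- a long bookkeeping proof assembling nine eventual conditions; the arithmetic is in the `_aux` lemmas
/-- **Core step.**  Under the Poisson law for prime-free windows (`P₀(g(N), N)/N → e^{−s}` whenever
`g(N)/log N → s > 0` — Gallagher's Theorem 1, `k = 0`), for every `t > 0`, `ε > 0` and `J` there is an
index `j ≥ J` with `|(p_{j+1} − p_j)/log p_j − t| < ε` (Merikoski §1: "we expect the sequence of
normalized prime gaps to satisfy a Poisson distribution … Gallagher has shown this to be true assuming a
sufficiently uniform version of the Hardy–Littlewood conjecture"; the passage from the window law to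
individual gaps is made explicit here via `secondDiff_exactCount_le`).
[cite: Merikoski2020GapLimitPoints, Section 1 eq. (1.1)] [cite: Gallagher1976, Theorem 1] -/
theorem exists_normalizedPrimeGap_near
    (hP : ∀ s : ℝ, 0 < s → ∀ g : ℕ → ℕ,
      Tendsto (fun N : ℕ => (g N : ℝ) / Real.log N) atTop (𝓝 s) →
      Tendsto (fun N : ℕ => (exactCount 0 (g N) N : ℝ) / N) atTop (𝓝 (Real.exp (-s))))
    {t ε : ℝ} (ht : 0 < t) (hε : 0 < ε) (J : ℕ) :
    ∃ j : ℕ, J ≤ j ∧ |normalizedPrimeGap j - t| < ε := by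
  classical
  -- parameters
  set δ : ℝ := min (ε / 4) (t / 2) with hδdef
  have hδpos : 0 < δ := lt_min (by positivity) (by positivity)
  have hδε : δ ≤ ε / 4 := min_le_left _ _
  have hδt : δ ≤ t / 2 := min_le_right _ _
  have htδ : 0 < t - δ := by linarith
  set H : ℕ → ℕ := fun N => ⌊t * Real.log N⌋₊ with hHdef
  set D : ℕ → ℕ := fun N => ⌊δ * Real.log N⌋₊ with hDdef
  have hDH : ∀ N, D N ≤ H N := fun N =>
    Nat.floor_le_floor (mul_le_mul_of_nonneg_right (by linarith) (Real.log_natCast_nonneg N))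
  -- the three windows and their Poisson limits
  have hH : Tendsto (fun N : ℕ => (H N : ℝ) / Real.log N) atTop (𝓝 t) :=
    tendsto_floor_mul_log_div ht.le
  have hD : Tendsto (fun N : ℕ => (D N : ℝ) / Real.log N) atTop (𝓝 δ) :=
    tendsto_floor_mul_log_div hδpos.le
  have hminus : Tendsto (fun N : ℕ => ((H N - D N : ℕ) : ℝ) / Real.log N) atTop (𝓝 (t - δ)) := by
    refine (hH.sub hD).congr fun N => ?_
    rw [Nat.cast_sub (hDH N), sub_div]
  have hplus : Tendsto (fun N : ℕ => ((H N + D N : ℕ) : ℝ) / Real.log N) atTop (𝓝 (t + δ)) := by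
    refine (hH.add hD).congr fun N => ?_
    rw [Nat.cast_add, add_div]
  have ha := hP (t - δ) htδ (fun N => H N - D N) hminus
  have hb := hP t ht H hH
  have hc := hP (t + δ) (by linarith) (fun N => H N + D N) hplus
  set κ : ℝ := Real.exp (-(t - δ)) - 2 * Real.exp (-t) + Real.exp (-(t + δ)) with hκdef
  have hκ : 0 < κ := exp_secondDiff_pos t hδpos.ne'
  have hs : Tendsto (fun N : ℕ => (exactCount 0 (H N - D N) N : ℝ) / N -
      2 * ((exactCount 0 (H N) N : ℝ) / N) + (exactCount 0 (H N + D N) N : ℝ) / N) atTop (𝓝 κ) :=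
    (ha.sub (hb.const_mul 2)).add hc
  -- eventual conditions
  have e1 := (tendsto_order.1 hs).1 (κ / 2) (by linarith)
  have e2 : ∀ᶠ N : ℕ in atTop, (1 : ℝ) ≤ D N := by
    have : Tendsto (fun N : ℕ => δ * Real.log N) atTop atTop :=
      tendsto_log_natCast_atTop.const_mul_atTop hδpos
    filter_upwards [this.eventually (eventually_ge_atTop 1)] with N hN
    exact_mod_cast Nat.le_floor (a := δ * Real.log N) (n := 1) (by exact_mod_cast hN)
  have e3 : ∀ᶠ N : ℕ in atTop, 4 * δ / κ ≤ Real.log N :=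
    tendsto_log_natCast_atTop.eventually (eventually_ge_atTop _)
  have e4 : ∀ᶠ N : ℕ in atTop, Real.log N ≤ (κ / (8 * δ)) * N := by
    simpa using eventually_pow_log_le 1 (c := κ / (8 * δ)) (by positivity)
  have e5 : ∀ᶠ N : ℕ in atTop, Real.log N ^ 2 ≤ (1 / ((Nat.nth Nat.Prime J : ℝ) + 1)) * N :=
    eventually_pow_log_le 2 (by positivity)
  have e6 : ∀ᶠ N : ℕ in atTop, Real.log (Real.log N) ≤ (δ / (2 * (t + 2 * δ))) * Real.log N :=
    eventually_loglog_le (by positivity)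
  have e7 : ∀ᶠ N : ℕ in atTop, 1 / δ ≤ Real.log N :=
    tendsto_log_natCast_atTop.eventually (eventually_ge_atTop _)
  have e8 : ∀ᶠ N : ℕ in atTop, Real.log (Real.log N) ≤ (1 / 4) * Real.log N :=
    eventually_loglog_le (by norm_num)
  have e9 : ∀ᶠ N : ℕ in atTop, (2 : ℕ) ≤ N := eventually_ge_atTop 2
  obtain ⟨N, hN1, hN2, hN3, hN4, hN5, hN6, hN7, hN8, hN9⟩ :=
    (e1.and (e2.and (e3.and (e4.and (e5.and (e6.and (e7.and (e8.and e9)))))))).exists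
  -- from here on everything is about this one `N`
  set L : ℝ := Real.log N with hLdef
  have hNpos : (0 : ℝ) < N := by exact_mod_cast (by omega : 0 < N)
  have hL : 0 < L := Real.log_pos (by exact_mod_cast hN9)
  have hDle : (D N : ℝ) ≤ δ * L := Nat.floor_le (mul_nonneg hδpos.le hL.le)
  have hHle : (H N : ℝ) ≤ t * L := Nat.floor_le (mul_nonneg ht.le hL.le)
  have hHge : t * L - 1 ≤ H N := by
    have := Nat.lt_floor_add_one (t * L); linarith
  -- the prime set and its size
  set P := (Icc 1 N).filter fun p =>
    p.Prime ∧ H N - D N < nextPrime p - p ∧ nextPrime p - p < H N + D N with hPdef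
  have hineqR : (exactCount 0 (H N - D N) N : ℝ) - 2 * exactCount 0 (H N) N +
      exactCount 0 (H N + D N) N ≤ D N * ((#P : ℝ) + 1) := by
    have := secondDiff_exactCount_le (hDH N) N
    have h' : ((exactCount 0 (H N - D N) N : ℤ) : ℝ) - 2 * ((exactCount 0 (H N) N : ℤ) : ℝ) +
        ((exactCount 0 (H N + D N) N : ℤ) : ℝ) ≤ ((D N : ℤ) : ℝ) * ((#P : ℤ) : ℝ) + ((D N : ℤ) : ℝ) := by
      exact_mod_cast this
    push_cast at h'
    linarith
  have hT : κ / 2 * N < (exactCount 0 (H N - D N) N : ℝ) - 2 * exactCount 0 (H N) N +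
      exactCount 0 (H N + D N) N := by
    have := mul_lt_mul_of_pos_right hN1 hNpos
    have hrw : ((exactCount 0 (H N - D N) N : ℝ) / N - 2 * ((exactCount 0 (H N) N : ℝ) / N) +
        (exactCount 0 (H N + D N) N : ℝ) / N) * N =
        (exactCount 0 (H N - D N) N : ℝ) - 2 * exactCount 0 (H N) N + exactCount 0 (H N + D N) N := by
      field_simp
    linarith [hrw]
  have hcardP : κ * N / (2 * (δ * L)) - 1 ≤ #P :=
    card_lower_aux hδpos hL (Nat.cast_nonneg _) hT hineqR hDle
  -- `#P > M := ⌊N / L²⌋`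
  set M : ℕ := ⌊(N : ℝ) / L ^ 2⌋₊ with hMdef
  have hMle : (M : ℝ) ≤ N / L ^ 2 := Nat.floor_le (by positivity)
  have hkey := key_aux hκ hδpos hL hNpos.le hN3 hN4
  have hPM : M < #P := by
    have : (M : ℝ) < #P := by linarith
    exact_mod_cast this
  -- a prime `p ∈ P` beyond `M`
  obtain ⟨p, hpP, hpM⟩ := exists_gt_of_card_gt (fun p hp => (mem_Icc.1 (mem_filter.1 hp).1).1) hPM
  simp only [mem_filter, mem_Icc] at hpP
  obtain ⟨⟨hp1, hpN⟩, hp, hglo, hghi⟩ := hpP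
  -- size of `p`
  have hpgt : (N : ℝ) / L ^ 2 < p := by
    calc (N : ℝ) / L ^ 2 < M + 1 := Nat.lt_floor_add_one _
      _ ≤ p := by exact_mod_cast hpM
  have hlogp_le : Real.log p ≤ L :=
    Real.log_le_log (by exact_mod_cast hp.pos) (by exact_mod_cast hpN)
  have hL' : 0 < L - 2 * Real.log L := by linarith
  have hlogp_gt : L - 2 * Real.log L < Real.log p := by
    have : Real.log ((N : ℝ) / L ^ 2) = L - 2 * Real.log L := by
      rw [Real.log_div hNpos.ne' (by positivity), Real.log_pow]; push_cast; ring
    rw [← this]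
    exact Real.log_lt_log (by positivity) hpgt
  have hlogp_pos : 0 < Real.log p := hL'.trans hlogp_gt
  -- the gap `g = nextPrime p − p`
  set g : ℕ := nextPrime p - p with hgdef
  have hgR_hi : (g : ℝ) < (t + δ) * L := by
    have : (g : ℝ) < (H N : ℝ) + D N := by exact_mod_cast hghi
    linarith
  have hgR_lo : (t - δ) * L - 1 < g := by
    have h1 : ((H N - D N : ℕ) : ℝ) < g := by exact_mod_cast hglo
    rw [Nat.cast_sub (hDH N)] at h1
    linarith
  have hupper : (g : ℝ) / Real.log p < t + 2 * δ :=
    upper_aux ht hδpos (Nat.cast_nonneg _) hgR_hi hL' hlogp_gt hN6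
  have hlower : t - 2 * δ < (g : ℝ) / Real.log p :=
    lower_aux hδpos hL (Nat.cast_nonneg _) hgR_lo hlogp_pos hlogp_le hN7
  -- the index `j` of `p`
  refine ⟨Nat.count Nat.Prime p, ?_, ?_⟩
  · -- `J ≤ j`: `p > M ≥ p_J`
    have hMJ : Nat.nth Nat.Prime J < p := by
      have h1' : ((Nat.nth Nat.Prime J : ℝ) + 1) * L ^ 2 ≤ N := by
        have := mul_le_mul_of_nonneg_left hN5 (by positivity : (0 : ℝ) ≤ (Nat.nth Nat.Prime J : ℝ) + 1)
        rwa [← mul_assoc, mul_one_div_cancel (by positivity), one_mul] at this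
      have h1 : (Nat.nth Nat.Prime J : ℝ) + 1 ≤ N / L ^ 2 := by
        rw [le_div_iff₀ (by positivity)]; exact h1'
      have h2 : (Nat.nth Nat.Prime J : ℝ) < p := by linarith
      exact_mod_cast h2
    exact ((Nat.lt_nth_iff_count_lt Nat.infinite_setOf_prime).2 hMJ).le
  · have hnth : Nat.nth Nat.Prime (Nat.count Nat.Prime p) = p := Nat.nth_count hp
    have hnext : Nat.nth Nat.Prime (Nat.count Nat.Prime p + 1) = nextPrime p := by
      rw [← nextPrime_nth_prime, hnth]
    have hval : normalizedPrimeGap (Nat.count Nat.Prime p) = (g : ℝ) / Real.log p := by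
      rw [normalizedPrimeGap, hnext, hnth, hgdef, Nat.cast_sub (lt_nextPrime p).le]
    rw [hval, abs_lt]
    constructor <;> linarith

/-- **Poisson law for prime-free windows ⇒ every `t ≥ 0` is a limit point of normalized prime gaps.**
If `P₀(g(N), N)/N → e^{−s}` for every `s > 0` and every `g` with `g(N)/log N → s` (the `k = 0` case of
Gallagher's Theorem 1, uniformly in the normalization), then `[0, ∞) ⊆ 𝓛 = primeGapLimitSet`
(Erdős's conjecture `𝓛 = [0, ∞]`, Merikoski §1, on its finite part, conditionally on the Poisson law;
`0 ∈ 𝓛` by closedness). [cite: Merikoski2020GapLimitPoints, Section 1 eq. (1.1)]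
[cite: Gallagher1976, Theorem 1] -/
theorem Ici_subset_primeGapLimitSet_of_poisson
    (hP : ∀ s : ℝ, 0 < s → ∀ g : ℕ → ℕ,
      Tendsto (fun N : ℕ => (g N : ℝ) / Real.log N) atTop (𝓝 s) →
      Tendsto (fun N : ℕ => (exactCount 0 (g N) N : ℝ) / N) atTop (𝓝 (Real.exp (-s)))) :
    Set.Ici (0 : ℝ) ⊆ primeGapLimitSet := by
  -- every `t > 0` is a limit point
  have hpos : Set.Ioi (0 : ℝ) ⊆ primeGapLimitSet := by
    intro t ht
    rw [Set.mem_Ioi] at ht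
    rw [mem_primeGapLimitSet, mapClusterPt_iff_frequently]
    intro s hs
    obtain ⟨ε, hε, hball⟩ := Metric.mem_nhds_iff.1 hs
    rw [frequently_atTop]
    intro J
    obtain ⟨j, hj, hclose⟩ := exists_normalizedPrimeGap_near hP ht hε J
    exact ⟨j, hj, hball (by rwa [Metric.mem_ball, Real.dist_eq])⟩
  -- `𝓛` is closed
  have hcl : closure (Set.Ioi (0 : ℝ)) ⊆ primeGapLimitSet :=
    (closure_mono hpos).trans isClosed_primeGapLimitSet.closure_subset
  rwa [closure_Ioi] at hcl

end Literature.NumberTheory.Sieve.Gallagher
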